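import Literature.MathematicalPhysics.QuantumFieldTheory.O2ScanObligations
import Literature.MathematicalPhysics.QuantumFieldTheory.ConformalBootstrap3D.BlockZSeries
import Literature.MathematicalPhysics.QuantumFieldTheory.ConformalBootstrap3D.BoundaryCellPositivity
import HarnessLib

/-!
# The neutral sectors `0⁺`, `0⁻`, `4` of an `O(2)` scan functional, termwise in the `z`-series

Sources: S. M. Chester, W. Landry, J. Liu, D. Poland, D. Simmons-Duffin, N. Su, A. Vichi, *Carving out OPE
space and precise O(2) model critical exponents*, JHEP 06 (2020) 142, arXiv:1912.03324, §2.1 (crossing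
equations), §3.1 (functional conditions), App. «Crossing vectors» (`ChesterEtAl2020`); M. Hogervorst,
S. Rychkov, *Radial coordinates for conformal blocks*, Phys. Rev. D 87 (2013) 106004, §3 eq. (3.6) (the
expansion `g_{Δ,ℓ} = Σ A_{n,j} 𝒫_{Δ+n,j}` with `A_{n,j} ≥ 0` above the unitarity bound), eq. (3.9), §4.3
(point functionals) (`HogervorstRychkov2013`); F. Kos, D. Poland, D. Simmons-Duffin, *Bootstrapping mixed
correlators in the 3D Ising model*, JHEP 11 (2014) 109, §3.3 eq. (3.16) (a `2 × 2`/`3 × 3` functional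
condition is positive-semidefiniteness of a matrix of numbers), §4 eqs. (4.2)–(4.3) (blocks at the boundary of
the allowed region as limits of generic blocks) (`KosPolandSimmonsduffin2014`).

WHAT THIS FILE DOES.  The `O(2)` three-scalar system of `ChesterEtAl2020` (`O2ThreeScalarSystem`,
`O2ScanObligations`) asks of a functional `α`, sector by sector and `(Δ, ℓ)` by `(Δ, ℓ)`, that the matrix
`α(V⃗_{q,Δ,ℓ}[g])` be positive-semidefinite for every GENUINE block family `g` (`Pos0p`, `Pos0m`, …, `Pos4`).
Three of the seven sectors — `0⁺` (`3 × 3`, labels `φφφφ, tttt, ssss, ttφφ, ttss, φφss`), `0⁻` (`2 × 2`,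
labels `φφφφ, tttt, ttφφ`) and `4` (scalar, label `tttt`) — involve only labels with `Δ_ij = Δ_kl = 0`
(`d12 = d34 = 0`), i.e. only the EQUAL-DIMENSION blocks `g^{0,0}_{Δ,ℓ}`, whose `z`-series
`g = Σ_{(n,j)} (A_{n,j}/λ_ℓ) 𝒫_{Δ+n,j}` has NON-NEGATIVE coefficients above the unitarity bound at regular
points (`hrCoeff_nonneg`, `HogervorstRychkov2013` eq. (3.6)).  For a SCAN FUNCTIONAL (`ScanFunctional`: a
point functional `α = Σ_m Σ_r w_{m r} ev_{(u_m,v_m)}` with nodes `u_m = z_m z̄_m`, `v_m = (1−z_m)(1−z̄_m)`,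
`z_m, z̄_m ∈ (0,1)`) this file proves, for these three sectors:

* §1 the DICTIONARY: the quadratic form `x ⬝ α(V⃗_{0⁺}[g]) x` (resp. `0⁻`, `4`) is an explicit real
  combination of the node numbers `Φ_r[F^x_∓[G_L]] = Σ_m w_{m r} F^x_∓[G_L](z_m, z̄_m)` of the
  `z`-coordinate blocks `G_L = pullbackZ (g L)` (`sector0pForm_eq`, `sector0mForm_eq`, `sector4Value_eq`) —
  bookkeeping over the printed crossing vectors (`quad0p_eq`, `quad0m_eq`, `V4`);
* §2 the TERM FORMS `q^{0⁺}_{E,j}(a,b,c)`, `q^{0⁻}_{E,j}(b,c)`, `q^{4}_{E,j}` (the same combinations with every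
  block replaced by the monomial `𝒫_{E,j}`) and the `z`-SERIES IDENTITIES
  `x ⬝ α(V⃗[g]) x = Σ_{(n,j)} (A_{n,j}(Δ,ℓ)/λ_ℓ) · q_{Δ+n,j}(x)` for genuine `g` at a regular `(Δ, ℓ)` above the
  unitarity bound (`hasSum_sector0pForm`, `hasSum_sector0mForm`, `hasSum_sector4Value`);
* §3 the TERMWISE RULES: if a finite head `Σ_{(n,j) ∈ F} (A_{n,j}/λ_ℓ) q_{Δ+n,j}` is a PSD form and every
  term form outside `F` in the descendant range is PSD, then `Pos0p α D Δ ℓ` (resp. `Pos0m`, `Pos4`) holds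
  (`pos0p_of_termwise`, `pos0m_of_termwise`, `pos4_of_termwise`, and the fully termwise `…_of_forall`);
* §4 NON-REGULAR points `(Δ, ℓ)` (the unitarity bound itself, the accidental degeneracies) by RIGHT LIMITS:
  if `(Δ', ℓ)` is regular and the sector form is `≥ 0` on genuine blocks for all `Δ'` in a right
  neighbourhood of `Δ`, the sector condition holds at `(Δ, ℓ)` (`pos0p_of_eventually_right`, `pos0m_…`,
  `pos4_…`; limit clause of `IsConformalBlock3D`, continuity of the finitely many node values).

HONEST SCOPE.  (i) Only the three neutral sectors are treated: the charged sectors `1`, `2±`, `3` pair blocks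
with `Δ_ij, Δ_kl ≠ 0` (labels `tφtφ, φsφs, tsts, …`), whose `z`-series coefficients carry signs, and are NOT
covered here.  (ii) The series identities and termwise rules (§2–§3) are stated at REGULAR points strictly above the
unitarity bound (`unitarityBound3D ℓ < Δ`, `¬ accidentalDegeneracy3D Δ ℓ`); §4 reaches a non-regular point
only from positivity on a whole right neighbourhood, and the argument UNIFORM in `Δ'` that would supply it
(a cell rule) is not part of this file.  (iii) The file decides NO instance: whether a given functional's term
forms are PSD is a statement about finitely many real numbers per term, to be certified by a client (interval
arithmetic); nothing here asserts that any particular functional satisfies the hypotheses, and no bound on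
any CFT quantity is claimed.  DECLARATIONS: this file declares definitions (`nodeEval`, `sector0pForm`,
`sector0mForm`, `sector4Value`, `sector0pTermForm`, `sector0mTermForm`, `sector4Term`).
-/

namespace Literature.MathematicalPhysics.QuantumFieldTheory.O2NeutralSectorsTermwise

open Finset Set Matrix Filter Topology
open Literature.MathematicalPhysics.QuantumFieldTheory.O2ThreeScalarCrossing
open Literature.MathematicalPhysics.QuantumFieldTheory.O2ThreeScalarSystem
open Literature.MathematicalPhysics.QuantumFieldTheory.O2OPEScanBridge
open Literature.MathematicalPhysics.QuantumFieldTheory.O2ScanObligations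
open ConformalBootstrap3D (IsConformalBlock3D IsConformalBlock3DAbove IsRegularPoint3D unitarityBound3D
  accidentalDegeneracy3D crossF pointFunctional pointFunctional_apply zMono hrCoeff legendreLam
  InDescendantRange hrCoeff_nonneg hrCoeff_eq_zero_of_not_inDescendantRange legendreLam_pos
  hasSum_pointFunctional_crossF_hrZ tendsto_pointFunctional_crossF)

/-! ### §0 Bookkeeping: a sum over `Fin 22` spelled out -/

/-- `Σ_{r < 22} f r` written out. Bookkeeping. [cite: ChesterEtAl2020, §2.1 (22 crossing equations)] -/
theorem sum_univ_fin22 (f : Fin 22 → ℝ) :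
    ∑ r, f r = f 0 + f 1 + f 2 + f 3 + f 4 + f 5 + f 6 + f 7 + f 8 + f 9 + f 10 + f 11 + f 12 + f 13 +
      f 14 + f 15 + f 16 + f 17 + f 18 + f 19 + f 20 + f 21 := by
  have h : f = ![f 0, f 1, f 2, f 3, f 4, f 5, f 6, f 7, f 8, f 9, f 10, f 11, f 12, f 13, f 14, f 15, f 16,
      f 17, f 18, f 19, f 20, f 21] := by
    funext r; fin_cases r <;> rfl
  conv_lhs => rw [h]
  simp only [Fin.sum_univ_succ, Fin.sum_univ_zero, Matrix.cons_val_zero, Matrix.cons_val_succ]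
  ring

/-! ### §1 The dictionary: sector forms of a scan functional as combinations of node numbers -/

/-- The node number of row `r` on a `z`-coordinate function `H`: `Φ_r[H] = Σ_m w_{m r} H(z_m, z̄_m)` (the
one-component point functional of `HogervorstRychkov2013` §4.3 built from column `r` of the weights).
[cite: HogervorstRychkov2013, §4.3] [cite: ChesterEtAl2020, §3.1 (functional conditions)] -/
noncomputable def nodeEval (F : ScanFunctional) (r : Fin 22) (H : ℝ → ℝ → ℝ) : ℝ :=
  pointFunctional (fun m => F.w m r) F.z F.zb H

/-- Unfolding of `nodeEval`. [cite: HogervorstRychkov2013, §4.3] -/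
theorem nodeEval_apply (F : ScanFunctional) (r : Fin 22) (H : ℝ → ℝ → ℝ) :
    nodeEval F r H = ∑ m, F.w m r * H (F.z m) (F.zb m) :=
  rfl

/-- **The `0⁺` sector form** of a scan functional on a family `G` of `z`-coordinate functions, basis
`(a, b, c) = (λ_{ss𝒪}, λ_{φφ𝒪}, λ_{tt𝒪})`:
`a²·2Φ₁₂[F⁻_{Δs}G_{ssss}] + b²·(2Φ₀[F⁻_{Δφ}G_{φφφφ}] − 2Φ₂[F⁺_{Δφ}G_{φφφφ}])
 + c²·(2Φ₃[F⁻_{Δt}G_{tttt}] − 2Φ₅[F⁺_{Δt}G_{tttt}])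
 + bc·(2Φ₈[F⁻G_{ttφφ}] + 2Φ₉[F⁻G_{ttφφ}] − 2Φ₁₀[F⁺G_{ttφφ}] − 2Φ₁₁[F⁺G_{ttφφ}])
 + ac·(2Φ₁₅[F⁻G_{ttss}] + 2Φ₁₆[F⁺G_{ttss}]) + ab·(2Φ₁₇[F⁻G_{φφss}] + 2Φ₁₈[F⁺G_{φφss}])`
(rows numbered from `0`; exponents `D.expo L`). [cite: ChesterEtAl2020, App. «Crossing vectors» (`V⃗_{0⁺,Δ,ℓ⁺}`)] -/
noncomputable def sector0pForm (F : ScanFunctional) (D : Dims) (G : Label → ℝ → ℝ → ℝ) (a b c : ℝ) : ℝ :=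
  a ^ 2 * (2 * nodeEval F 12 (crossF (D.expo .ssss) (-1) (G .ssss))) +
    b ^ 2 * (2 * nodeEval F 0 (crossF (D.expo .φφφφ) (-1) (G .φφφφ)) -
      2 * nodeEval F 2 (crossF (D.expo .φφφφ) 1 (G .φφφφ))) +
    c ^ 2 * (2 * nodeEval F 3 (crossF (D.expo .tttt) (-1) (G .tttt)) -
      2 * nodeEval F 5 (crossF (D.expo .tttt) 1 (G .tttt))) +
    b * c * (2 * nodeEval F 8 (crossF (D.expo .ttφφ) (-1) (G .ttφφ)) +
      2 * nodeEval F 9 (crossF (D.expo .ttφφ) (-1) (G .ttφφ)) -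
      2 * nodeEval F 10 (crossF (D.expo .ttφφ) 1 (G .ttφφ)) -
      2 * nodeEval F 11 (crossF (D.expo .ttφφ) 1 (G .ttφφ))) +
    a * c * (2 * nodeEval F 15 (crossF (D.expo .ttss) (-1) (G .ttss)) +
      2 * nodeEval F 16 (crossF (D.expo .ttss) 1 (G .ttss))) +
    a * b * (2 * nodeEval F 17 (crossF (D.expo .φφss) (-1) (G .φφss)) +
      2 * nodeEval F 18 (crossF (D.expo .φφss) 1 (G .φφss)))

/-- **Dictionary, sector `0⁺`**: for a scan functional, `(a b c) α(V⃗_{0⁺}[g]) (a;b;c)` is the `0⁺` sector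
form of the `z`-coordinate blocks `G_L = pullbackZ (g L)`. Bookkeeping over the printed `V⃗_{0⁺}`.
[cite: ChesterEtAl2020, App. «Crossing vectors» (`V⃗_{0⁺,Δ,ℓ⁺}`), §3.1 (functional conditions)] -/
theorem sector0pForm_eq (F : ScanFunctional) (D : Dims) (g : Label → ℝ → ℝ → ℝ) (a b c : ℝ) :
    ![a, b, c] ⬝ᵥ (alphaMat F.toFunctional (V0p D g) *ᵥ ![a, b, c]) =
      sector0pForm F D (fun L => pullbackZ (g L)) a b c := by
  rw [alpha_quad0p, ScanFunctional.toFunctional, pointFunctional₂₂_apply]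
  have hnode : ∀ m : Fin F.M, ∑ r, F.w m r * quad0p D a b c g (F.u m) (F.v m) r =
      a ^ 2 * (2 * (F.w m 12 * crossF (D.expo .ssss) (-1) (pullbackZ (g .ssss)) (F.z m) (F.zb m))) +
        b ^ 2 * (2 * (F.w m 0 * crossF (D.expo .φφφφ) (-1) (pullbackZ (g .φφφφ)) (F.z m) (F.zb m)) -
          2 * (F.w m 2 * crossF (D.expo .φφφφ) 1 (pullbackZ (g .φφφφ)) (F.z m) (F.zb m))) +
        c ^ 2 * (2 * (F.w m 3 * crossF (D.expo .tttt) (-1) (pullbackZ (g .tttt)) (F.z m) (F.zb m)) -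
          2 * (F.w m 5 * crossF (D.expo .tttt) 1 (pullbackZ (g .tttt)) (F.z m) (F.zb m))) +
        b * c * (2 * (F.w m 8 * crossF (D.expo .ttφφ) (-1) (pullbackZ (g .ttφφ)) (F.z m) (F.zb m)) +
          2 * (F.w m 9 * crossF (D.expo .ttφφ) (-1) (pullbackZ (g .ttφφ)) (F.z m) (F.zb m)) -
          2 * (F.w m 10 * crossF (D.expo .ttφφ) 1 (pullbackZ (g .ttφφ)) (F.z m) (F.zb m)) -
          2 * (F.w m 11 * crossF (D.expo .ttφφ) 1 (pullbackZ (g .ttφφ)) (F.z m) (F.zb m))) +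
        a * c * (2 * (F.w m 15 * crossF (D.expo .ttss) (-1) (pullbackZ (g .ttss)) (F.z m) (F.zb m)) +
          2 * (F.w m 16 * crossF (D.expo .ttss) 1 (pullbackZ (g .ttss)) (F.z m) (F.zb m))) +
        a * b * (2 * (F.w m 17 * crossF (D.expo .φφss) (-1) (pullbackZ (g .φφss)) (F.z m) (F.zb m)) +
          2 * (F.w m 18 * crossF (D.expo .φφss) 1 (pullbackZ (g .φφss)) (F.z m) (F.zb m))) := by
    intro m
    rw [sum_univ_fin22, quad0p_eq]
    simp only [ScanFunctional.u, ScanFunctional.v, Fminus_pullbackZ, Fplus_pullbackZ]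
    simp
    ring
  rw [Finset.sum_congr rfl fun m _ => hnode m]
  simp only [sector0pForm, nodeEval_apply, Finset.mul_sum, ← Finset.sum_add_distrib,
    ← Finset.sum_sub_distrib]

/-- **The `0⁻` sector form**, basis `(b, c) = (λ_{φφ𝒪}, λ_{tt𝒪})`:
`b²·(2Φ₀[F⁻G_{φφφφ}] − 4Φ₁[F⁻G_{φφφφ}] + 2Φ₂[F⁺G_{φφφφ}]) + c²·(2Φ₃[F⁻G_{tttt}] − 4Φ₄[F⁻G_{tttt}] + 2Φ₅[F⁺G_{tttt}])
 + bc·(−2Φ₈[F⁻G_{ttφφ}] + 2Φ₉[F⁻G_{ttφφ}] + 2Φ₁₀[F⁺G_{ttφφ}] − 2Φ₁₁[F⁺G_{ttφφ}])`.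
[cite: ChesterEtAl2020, App. «Crossing vectors» (`V⃗_{0⁻,Δ,ℓ⁻}`)] -/
noncomputable def sector0mForm (F : ScanFunctional) (D : Dims) (G : Label → ℝ → ℝ → ℝ) (b c : ℝ) : ℝ :=
  b ^ 2 * (2 * nodeEval F 0 (crossF (D.expo .φφφφ) (-1) (G .φφφφ)) -
      4 * nodeEval F 1 (crossF (D.expo .φφφφ) (-1) (G .φφφφ)) +
      2 * nodeEval F 2 (crossF (D.expo .φφφφ) 1 (G .φφφφ))) +
    c ^ 2 * (2 * nodeEval F 3 (crossF (D.expo .tttt) (-1) (G .tttt)) -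
      4 * nodeEval F 4 (crossF (D.expo .tttt) (-1) (G .tttt)) +
      2 * nodeEval F 5 (crossF (D.expo .tttt) 1 (G .tttt))) +
    b * c * (-(2 * nodeEval F 8 (crossF (D.expo .ttφφ) (-1) (G .ttφφ))) +
      2 * nodeEval F 9 (crossF (D.expo .ttφφ) (-1) (G .ttφφ)) +
      2 * nodeEval F 10 (crossF (D.expo .ttφφ) 1 (G .ttφφ)) -
      2 * nodeEval F 11 (crossF (D.expo .ttφφ) 1 (G .ttφφ)))

/-- **Dictionary, sector `0⁻`**: `(b c) α(V⃗_{0⁻}[g]) (b;c)` of a scan functional is the `0⁻` sector form of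
the `z`-coordinate blocks. Bookkeeping over the printed `V⃗_{0⁻}`.
[cite: ChesterEtAl2020, App. «Crossing vectors» (`V⃗_{0⁻,Δ,ℓ⁻}`), §3.1 (functional conditions)] -/
theorem sector0mForm_eq (F : ScanFunctional) (D : Dims) (g : Label → ℝ → ℝ → ℝ) (b c : ℝ) :
    ![b, c] ⬝ᵥ (alphaMat F.toFunctional (V0m D g) *ᵥ ![b, c]) =
      sector0mForm F D (fun L => pullbackZ (g L)) b c := by
  rw [alphaMat_quadForm, show quadVec ![b, c] (V0m D g) = quad0m D b c g from rfl,
    ScanFunctional.toFunctional, pointFunctional₂₂_apply]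
  have hnode : ∀ m : Fin F.M, ∑ r, F.w m r * quad0m D b c g (F.u m) (F.v m) r =
      b ^ 2 * (2 * (F.w m 0 * crossF (D.expo .φφφφ) (-1) (pullbackZ (g .φφφφ)) (F.z m) (F.zb m)) -
          4 * (F.w m 1 * crossF (D.expo .φφφφ) (-1) (pullbackZ (g .φφφφ)) (F.z m) (F.zb m)) +
          2 * (F.w m 2 * crossF (D.expo .φφφφ) 1 (pullbackZ (g .φφφφ)) (F.z m) (F.zb m))) +
        c ^ 2 * (2 * (F.w m 3 * crossF (D.expo .tttt) (-1) (pullbackZ (g .tttt)) (F.z m) (F.zb m)) -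
          4 * (F.w m 4 * crossF (D.expo .tttt) (-1) (pullbackZ (g .tttt)) (F.z m) (F.zb m)) +
          2 * (F.w m 5 * crossF (D.expo .tttt) 1 (pullbackZ (g .tttt)) (F.z m) (F.zb m))) +
        b * c * (-(2 * (F.w m 8 * crossF (D.expo .ttφφ) (-1) (pullbackZ (g .ttφφ)) (F.z m) (F.zb m))) +
          2 * (F.w m 9 * crossF (D.expo .ttφφ) (-1) (pullbackZ (g .ttφφ)) (F.z m) (F.zb m)) +
          2 * (F.w m 10 * crossF (D.expo .ttφφ) 1 (pullbackZ (g .ttφφ)) (F.z m) (F.zb m)) -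
          2 * (F.w m 11 * crossF (D.expo .ttφφ) 1 (pullbackZ (g .ttφφ)) (F.z m) (F.zb m))) := by
    intro m
    rw [sum_univ_fin22, quad0m_eq]
    simp only [ScanFunctional.u, ScanFunctional.v, Fminus_pullbackZ, Fplus_pullbackZ]
    simp
    ring
  rw [Finset.sum_congr rfl fun m _ => hnode m]
  simp only [sector0mForm, nodeEval_apply, Finset.mul_sum, ← Finset.sum_add_distrib,
    ← Finset.sum_sub_distrib, ← Finset.sum_neg_distrib]

/-- **The sector-`4` value** (scalar): `2Φ₄[F⁻_{Δt}G_{tttt}] + 2Φ₅[F⁺_{Δt}G_{tttt}]`.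
[cite: ChesterEtAl2020, App. «Crossing vectors» (`V⃗_{4,Δ,ℓ⁺}`)] -/
noncomputable def sector4Value (F : ScanFunctional) (D : Dims) (G : Label → ℝ → ℝ → ℝ) : ℝ :=
  2 * nodeEval F 4 (crossF (D.expo .tttt) (-1) (G .tttt)) + 2 * nodeEval F 5 (crossF (D.expo .tttt) 1 (G .tttt))

/-- **Dictionary, sector `4`**: `α(V⃗_4[g])` of a scan functional is the sector-`4` value of the
`z`-coordinate blocks. Bookkeeping over the printed `V⃗_4`.
[cite: ChesterEtAl2020, App. «Crossing vectors» (`V⃗_{4,Δ,ℓ⁺}`), §3.1 (functional conditions)] -/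
theorem sector4Value_eq (F : ScanFunctional) (D : Dims) (g : Label → ℝ → ℝ → ℝ) :
    F.toFunctional (V4 D g) = sector4Value F D (fun L => pullbackZ (g L)) := by
  rw [ScanFunctional.toFunctional, pointFunctional₂₂_apply]
  have hnode : ∀ m : Fin F.M, ∑ r, F.w m r * V4 D g (F.u m) (F.v m) r =
      2 * (F.w m 4 * crossF (D.expo .tttt) (-1) (pullbackZ (g .tttt)) (F.z m) (F.zb m)) +
        2 * (F.w m 5 * crossF (D.expo .tttt) 1 (pullbackZ (g .tttt)) (F.z m) (F.zb m)) := by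
    intro m
    rw [sum_univ_fin22]
    simp only [V4, ScanFunctional.u, ScanFunctional.v, Fminus_pullbackZ, Fplus_pullbackZ]
    simp
    ring
  rw [Finset.sum_congr rfl fun m _ => hnode m]
  simp only [sector4Value, nodeEval_apply, Finset.mul_sum, ← Finset.sum_add_distrib]

/-! ### §2 The term forms and the `z`-series identities at a regular point -/

/-- **The `0⁺` term form at `𝒫_{E,j}`**: the `0⁺` sector form with every block replaced by the monomial
`𝒫_{E,j}` — an explicit quadratic form in `(a, b, c)` whose coefficients are finitely many real numbers.
[cite: HogervorstRychkov2013, §3 eq. (3.9)] [cite: ChesterEtAl2020, App. «Crossing vectors» (`V⃗_{0⁺,Δ,ℓ⁺}`)] -/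
noncomputable def sector0pTermForm (F : ScanFunctional) (D : Dims) (E : ℝ) (j : ℕ) (a b c : ℝ) : ℝ :=
  sector0pForm F D (fun _ => zMono E j) a b c

/-- **The `0⁻` term form at `𝒫_{E,j}`.** [cite: HogervorstRychkov2013, §3 eq. (3.9)]
[cite: ChesterEtAl2020, App. «Crossing vectors» (`V⃗_{0⁻,Δ,ℓ⁻}`)] -/
noncomputable def sector0mTermForm (F : ScanFunctional) (D : Dims) (E : ℝ) (j : ℕ) (b c : ℝ) : ℝ :=
  sector0mForm F D (fun _ => zMono E j) b c

/-- **The sector-`4` term at `𝒫_{E,j}`.** [cite: HogervorstRychkov2013, §3 eq. (3.9)]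
[cite: ChesterEtAl2020, App. «Crossing vectors» (`V⃗_{4,Δ,ℓ⁺}`)] -/
noncomputable def sector4Term (F : ScanFunctional) (D : Dims) (E : ℝ) (j : ℕ) : ℝ :=
  sector4Value F D (fun _ => zMono E j)

/-- The labels of `V⃗_{0⁺}` have `Δ_ij = Δ_kl = 0`. [cite: ChesterEtAl2020, §2.1 (`F^{ij,kl}_{∓,Δ,ℓ}`)] -/
theorem d12_d34_eq_zero_of_mem_labels0p (D : Dims) {L : Label} (hL : L ∈ labels0p) :
    d12 D L = 0 ∧ d34 D L = 0 := by
  simp only [labels0p, List.mem_cons, List.not_mem_nil, or_false] at hL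
  rcases hL with rfl | rfl | rfl | rfl | rfl | rfl <;> exact ⟨rfl, rfl⟩

/-- The labels of `V⃗_{0⁻}` have `Δ_ij = Δ_kl = 0`. [cite: ChesterEtAl2020, §2.1 (`F^{ij,kl}_{∓,Δ,ℓ}`)] -/
theorem d12_d34_eq_zero_of_mem_labels0m (D : Dims) {L : Label} (hL : L ∈ labels0m) :
    d12 D L = 0 ∧ d34 D L = 0 := by
  simp only [labels0m, List.mem_cons, List.not_mem_nil, or_false] at hL
  rcases hL with rfl | rfl | rfl <;> exact ⟨rfl, rfl⟩

/-- The label of `V⃗_4` has `Δ_ij = Δ_kl = 0`. [cite: ChesterEtAl2020, §2.1 (`F^{ij,kl}_{∓,Δ,ℓ}`)] -/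
theorem d12_d34_eq_zero_of_mem_labels4 (D : Dims) {L : Label} (hL : L ∈ labels4) :
    d12 D L = 0 ∧ d34 D L = 0 := by
  simp only [labels4, List.mem_cons, List.not_mem_nil, or_false] at hL
  rcases hL with rfl; exact ⟨rfl, rfl⟩

/-- A genuine family on the `0⁺` labels consists of equal-dimension blocks: `pullbackZ (g L)` is
`g^{0,0}_{Δ,ℓ}` in `z`-coordinates for each label `L ∈ labels0p`. [cite: ChesterEtAl2020, §2.1 (`F^{ij,kl}_{∓,Δ,ℓ}`)] -/
theorem isConformalBlock3D_of_genuineOn_labels0p {D : Dims} {Δ : ℝ} {ℓ : ℕ} {g : Label → ℝ → ℝ → ℝ}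
    (hg : GenuineOn D labels0p Δ ℓ g) : ∀ L ∈ labels0p, IsConformalBlock3D 0 0 Δ ℓ (pullbackZ (g L)) := by
  intro L hL
  obtain ⟨h1, h2⟩ := d12_d34_eq_zero_of_mem_labels0p D hL
  have h := hg L hL
  rwa [IsBlockUV, h1, h2] at h

/-- The same on the `0⁻` labels. [cite: ChesterEtAl2020, §2.1 (`F^{ij,kl}_{∓,Δ,ℓ}`)] -/
theorem isConformalBlock3D_of_genuineOn_labels0m {D : Dims} {Δ : ℝ} {ℓ : ℕ} {g : Label → ℝ → ℝ → ℝ}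
    (hg : GenuineOn D labels0m Δ ℓ g) : ∀ L ∈ labels0m, IsConformalBlock3D 0 0 Δ ℓ (pullbackZ (g L)) := by
  intro L hL
  obtain ⟨h1, h2⟩ := d12_d34_eq_zero_of_mem_labels0m D hL
  have h := hg L hL
  rwa [IsBlockUV, h1, h2] at h

/-- The same on the sector-`4` label. [cite: ChesterEtAl2020, §2.1 (`F^{ij,kl}_{∓,Δ,ℓ}`)] -/
theorem isConformalBlock3D_of_genuineOn_labels4 {D : Dims} {Δ : ℝ} {ℓ : ℕ} {g : Label → ℝ → ℝ → ℝ}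
    (hg : GenuineOn D labels4 Δ ℓ g) : ∀ L ∈ labels4, IsConformalBlock3D 0 0 Δ ℓ (pullbackZ (g L)) := by
  intro L hL
  obtain ⟨h1, h2⟩ := d12_d34_eq_zero_of_mem_labels4 D hL
  have h := hg L hL
  rwa [IsBlockUV, h1, h2] at h

/-- **`z`-series identity, sector `0⁺`** (regular point above the unitarity bound; every `G_L`, `L` a `0⁺`
label, the genuine `g^{0,0}_{Δ,ℓ}` in `z`-coordinates):
`sector0pForm(G; a,b,c) = Σ_{(n,j)} (A_{n,j}(Δ,ℓ)/λ_ℓ) · q^{0⁺}_{Δ+n,j}(a,b,c)` — thirteen applications of the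
termwise action of a point functional on the Hogervorst–Rychkov series.
[cite: HogervorstRychkov2013, §3 eqs. (3.6), (3.9)] [cite: ChesterEtAl2020, §3.1 (functional conditions)] -/
theorem hasSum_sector0pForm (F : ScanFunctional) (D : Dims) {Δ : ℝ} {ℓ : ℕ} {G : Label → ℝ → ℝ → ℝ}
    (hΔ : unitarityBound3D ℓ < Δ) (hreg : ¬ accidentalDegeneracy3D Δ ℓ)
    (hG : ∀ L ∈ labels0p, IsConformalBlock3D 0 0 Δ ℓ (G L)) (a b c : ℝ) :
    HasSum (fun q : ℕ × ℕ => hrCoeff Δ ℓ q.1 q.2 / legendreLam ℓ *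
        sector0pTermForm F D (Δ + (q.1 : ℝ)) q.2 a b c) (sector0pForm F D G a b c) := by
  have hφ := hG .φφφφ (by simp [labels0p])
  have ht := hG .tttt (by simp [labels0p])
  have hs := hG .ssss (by simp [labels0p])
  have hφt := hG .ttφφ (by simp [labels0p])
  have hst := hG .ttss (by simp [labels0p])
  have hφs := hG .φφss (by simp [labels0p])
  have P := fun (r : Fin 22) (x sgn : ℝ) {H : ℝ → ℝ → ℝ} (hH : IsConformalBlock3D 0 0 Δ ℓ H) =>
    hasSum_pointFunctional_crossF_hrZ (fun m => F.w m r) F.z F.zb F.hz F.hzb x sgn hΔ hreg hH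
  have hsum :=
    ((((((P 12 (D.expo .ssss) (-1) hs).mul_left 2).mul_left (a ^ 2)).add
      ((((P 0 (D.expo .φφφφ) (-1) hφ).mul_left 2).sub ((P 2 (D.expo .φφφφ) 1 hφ).mul_left 2)).mul_left
        (b ^ 2))).add
      ((((P 3 (D.expo .tttt) (-1) ht).mul_left 2).sub ((P 5 (D.expo .tttt) 1 ht).mul_left 2)).mul_left
        (c ^ 2))).add
      ((((((P 8 (D.expo .ttφφ) (-1) hφt).mul_left 2).add ((P 9 (D.expo .ttφφ) (-1) hφt).mul_left 2)).sub
        ((P 10 (D.expo .ttφφ) 1 hφt).mul_left 2)).sub ((P 11 (D.expo .ttφφ) 1 hφt).mul_left 2)).mul_left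
        (b * c))).add
      ((((P 15 (D.expo .ttss) (-1) hst).mul_left 2).add ((P 16 (D.expo .ttss) 1 hst).mul_left 2)).mul_left
        (a * c)) |>.add
      ((((P 17 (D.expo .φφss) (-1) hφs).mul_left 2).add ((P 18 (D.expo .φφss) 1 hφs).mul_left 2)).mul_left
        (a * b))
  refine (hsum.congr_fun fun q => ?_)
  simp only [sector0pTermForm, sector0pForm, nodeEval]
  ring

/-- **`z`-series identity, sector `0⁻`.** [cite: HogervorstRychkov2013, §3 eqs. (3.6), (3.9)]
[cite: ChesterEtAl2020, §3.1 (functional conditions)] -/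
theorem hasSum_sector0mForm (F : ScanFunctional) (D : Dims) {Δ : ℝ} {ℓ : ℕ} {G : Label → ℝ → ℝ → ℝ}
    (hΔ : unitarityBound3D ℓ < Δ) (hreg : ¬ accidentalDegeneracy3D Δ ℓ)
    (hG : ∀ L ∈ labels0m, IsConformalBlock3D 0 0 Δ ℓ (G L)) (b c : ℝ) :
    HasSum (fun q : ℕ × ℕ => hrCoeff Δ ℓ q.1 q.2 / legendreLam ℓ *
        sector0mTermForm F D (Δ + (q.1 : ℝ)) q.2 b c) (sector0mForm F D G b c) := by
  have hφ := hG .φφφφ (by simp [labels0m])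
  have ht := hG .tttt (by simp [labels0m])
  have hφt := hG .ttφφ (by simp [labels0m])
  have P := fun (r : Fin 22) (x sgn : ℝ) {H : ℝ → ℝ → ℝ} (hH : IsConformalBlock3D 0 0 Δ ℓ H) =>
    hasSum_pointFunctional_crossF_hrZ (fun m => F.w m r) F.z F.zb F.hz F.hzb x sgn hΔ hreg hH
  have hsum :=
    ((((((P 0 (D.expo .φφφφ) (-1) hφ).mul_left 2).sub ((P 1 (D.expo .φφφφ) (-1) hφ).mul_left 4)).add
        ((P 2 (D.expo .φφφφ) 1 hφ).mul_left 2)).mul_left (b ^ 2)).add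
      (((((P 3 (D.expo .tttt) (-1) ht).mul_left 2).sub ((P 4 (D.expo .tttt) (-1) ht).mul_left 4)).add
        ((P 5 (D.expo .tttt) 1 ht).mul_left 2)).mul_left (c ^ 2))).add
      ((((((P 8 (D.expo .ttφφ) (-1) hφt).mul_left 2).neg.add ((P 9 (D.expo .ttφφ) (-1) hφt).mul_left 2)).add
        ((P 10 (D.expo .ttφφ) 1 hφt).mul_left 2)).sub ((P 11 (D.expo .ttφφ) 1 hφt).mul_left 2)).mul_left
        (b * c))
  refine (hsum.congr_fun fun q => ?_)
  simp only [sector0mTermForm, sector0mForm, nodeEval]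
  ring

/-- **`z`-series identity, sector `4`.** [cite: HogervorstRychkov2013, §3 eqs. (3.6), (3.9)]
[cite: ChesterEtAl2020, §3.1 (functional conditions)] -/
theorem hasSum_sector4Value (F : ScanFunctional) (D : Dims) {Δ : ℝ} {ℓ : ℕ} {G : Label → ℝ → ℝ → ℝ}
    (hΔ : unitarityBound3D ℓ < Δ) (hreg : ¬ accidentalDegeneracy3D Δ ℓ)
    (hG : ∀ L ∈ labels4, IsConformalBlock3D 0 0 Δ ℓ (G L)) :
    HasSum (fun q : ℕ × ℕ => hrCoeff Δ ℓ q.1 q.2 / legendreLam ℓ * sector4Term F D (Δ + (q.1 : ℝ)) q.2)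
      (sector4Value F D G) := by
  have ht := hG .tttt (by simp [labels4])
  have P := fun (r : Fin 22) (x sgn : ℝ) {H : ℝ → ℝ → ℝ} (hH : IsConformalBlock3D 0 0 Δ ℓ H) =>
    hasSum_pointFunctional_crossF_hrZ (fun m => F.w m r) F.z F.zb F.hz F.hzb x sgn hΔ hreg hH
  have hsum := ((P 4 (D.expo .tttt) (-1) ht).mul_left 2).add ((P 5 (D.expo .tttt) 1 ht).mul_left 2)
  refine (hsum.congr_fun fun q => ?_)
  simp only [sector4Term, sector4Value, nodeEval]
  ring

/-! ### §3 The termwise rules: a PSD head plus PSD tail terms give the sector condition -/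

/-- **The `0⁺` sector form is `≥ 0` from termwise PSD** (regular point; finite head + PSD tail terms): if
the head form `Σ_{(n,j) ∈ S} (A_{n,j}/λ_ℓ) q^{0⁺}_{Δ+n,j}` is `≥ 0` on all of `ℝ³` and every term form outside `S`
on the descendant range is `≥ 0` on all of `ℝ³`, then `sector0pForm(G; ·) ≥ 0` for every family `G` of
genuine `z`-coordinate blocks on the `0⁺` labels (`A_{n,j} ≥ 0`, `sum_le_hasSum`).
[cite: HogervorstRychkov2013, §3 eqs. (3.6), (3.9)] [cite: KosPolandSimmonsduffin2014, §3.3 eq. (3.16)] -/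
theorem sector0pForm_nonneg_of_termwise (F : ScanFunctional) (D : Dims) {Δ : ℝ} {ℓ : ℕ}
    (hΔ : unitarityBound3D ℓ < Δ) (hreg : ¬ accidentalDegeneracy3D Δ ℓ) (S : Finset (ℕ × ℕ))
    (hhead : ∀ a b c : ℝ, 0 ≤ ∑ q ∈ S, hrCoeff Δ ℓ q.1 q.2 / legendreLam ℓ *
      sector0pTermForm F D (Δ + (q.1 : ℝ)) q.2 a b c)
    (htail : ∀ q : ℕ × ℕ, q ∉ S → InDescendantRange ℓ q.1 q.2 →
      ∀ a b c : ℝ, 0 ≤ sector0pTermForm F D (Δ + (q.1 : ℝ)) q.2 a b c)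
    {G : Label → ℝ → ℝ → ℝ} (hG : ∀ L ∈ labels0p, IsConformalBlock3D 0 0 Δ ℓ (G L)) (a b c : ℝ) :
    0 ≤ sector0pForm F D G a b c := by
  have hS := hasSum_sector0pForm F D hΔ hreg hG a b c
  refine (hhead a b c).trans (sum_le_hasSum S (fun q hq => ?_) hS)
  by_cases hr : InDescendantRange ℓ q.1 q.2
  · exact mul_nonneg (div_nonneg (hrCoeff_nonneg hΔ _ _) (legendreLam_pos ℓ).le) (htail q hq hr a b c)
  · rw [hrCoeff_eq_zero_of_not_inDescendantRange Δ hr, zero_div, zero_mul]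

/-- **The `0⁻` sector form is `≥ 0` from termwise PSD** (regular point).
[cite: HogervorstRychkov2013, §3 eqs. (3.6), (3.9)] [cite: KosPolandSimmonsduffin2014, §3.3 eq. (3.16)] -/
theorem sector0mForm_nonneg_of_termwise (F : ScanFunctional) (D : Dims) {Δ : ℝ} {ℓ : ℕ}
    (hΔ : unitarityBound3D ℓ < Δ) (hreg : ¬ accidentalDegeneracy3D Δ ℓ) (S : Finset (ℕ × ℕ))
    (hhead : ∀ b c : ℝ, 0 ≤ ∑ q ∈ S, hrCoeff Δ ℓ q.1 q.2 / legendreLam ℓ *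
      sector0mTermForm F D (Δ + (q.1 : ℝ)) q.2 b c)
    (htail : ∀ q : ℕ × ℕ, q ∉ S → InDescendantRange ℓ q.1 q.2 →
      ∀ b c : ℝ, 0 ≤ sector0mTermForm F D (Δ + (q.1 : ℝ)) q.2 b c)
    {G : Label → ℝ → ℝ → ℝ} (hG : ∀ L ∈ labels0m, IsConformalBlock3D 0 0 Δ ℓ (G L)) (b c : ℝ) :
    0 ≤ sector0mForm F D G b c := by
  have hS := hasSum_sector0mForm F D hΔ hreg hG b c
  refine (hhead b c).trans (sum_le_hasSum S (fun q hq => ?_) hS)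
  by_cases hr : InDescendantRange ℓ q.1 q.2
  · exact mul_nonneg (div_nonneg (hrCoeff_nonneg hΔ _ _) (legendreLam_pos ℓ).le) (htail q hq hr b c)
  · rw [hrCoeff_eq_zero_of_not_inDescendantRange Δ hr, zero_div, zero_mul]

/-- **The sector-`4` value is `≥ 0` from termwise nonnegativity** (regular point).
[cite: HogervorstRychkov2013, §3 eqs. (3.6), (3.9)] -/
theorem sector4Value_nonneg_of_termwise (F : ScanFunctional) (D : Dims) {Δ : ℝ} {ℓ : ℕ}
    (hΔ : unitarityBound3D ℓ < Δ) (hreg : ¬ accidentalDegeneracy3D Δ ℓ) (S : Finset (ℕ × ℕ))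
    (hhead : 0 ≤ ∑ q ∈ S, hrCoeff Δ ℓ q.1 q.2 / legendreLam ℓ * sector4Term F D (Δ + (q.1 : ℝ)) q.2)
    (htail : ∀ q : ℕ × ℕ, q ∉ S → InDescendantRange ℓ q.1 q.2 → 0 ≤ sector4Term F D (Δ + (q.1 : ℝ)) q.2)
    {G : Label → ℝ → ℝ → ℝ} (hG : ∀ L ∈ labels4, IsConformalBlock3D 0 0 Δ ℓ (G L)) :
    0 ≤ sector4Value F D G := by
  have hS := hasSum_sector4Value F D hΔ hreg hG
  refine hhead.trans (sum_le_hasSum S (fun q hq => ?_) hS)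
  by_cases hr : InDescendantRange ℓ q.1 q.2
  · exact mul_nonneg (div_nonneg (hrCoeff_nonneg hΔ _ _) (legendreLam_pos ℓ).le) (htail q hq hr)
  · rw [hrCoeff_eq_zero_of_not_inDescendantRange Δ hr, zero_div, zero_mul]

/-- `Pos0p` of a scan functional from nonnegativity of the `0⁺` sector form on every family of genuine
`z`-coordinate blocks (symmetry of `α(V⃗_{0⁺})` from `V0p_transpose`; a real symmetric matrix with
nonnegative quadratic form is positive-semidefinite). [cite: ChesterEtAl2020, §3.1 ("`M ⪰ 0`")]
[cite: KosPolandSimmonsduffin2014, §3.3 eq. (3.16)] -/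
theorem pos0p_of_forall_sector0pForm_nonneg (F : ScanFunctional) (D : Dims) {Δ : ℝ} {ℓ : ℕ}
    (h : ∀ G : Label → ℝ → ℝ → ℝ, (∀ L ∈ labels0p, IsConformalBlock3D 0 0 Δ ℓ (G L)) →
      ∀ a b c : ℝ, 0 ≤ sector0pForm F D G a b c) :
    Pos0p F.toFunctional D Δ ℓ := by
  intro g hg
  refine PosSemidef.of_dotProduct_mulVec_nonneg (isHermitian_alphaMat _ (V0p_transpose D g)) fun x => ?_
  have hx : x = ![x 0, x 1, x 2] := by
    funext i; fin_cases i <;> rfl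
  rw [star_trivial, hx, sector0pForm_eq]
  exact h _ (isConformalBlock3D_of_genuineOn_labels0p hg) _ _ _

/-- `Pos0m` of a scan functional from nonnegativity of the `0⁻` sector form. [cite: ChesterEtAl2020, §3.1 ("`M ⪰ 0`")]
[cite: KosPolandSimmonsduffin2014, §3.3 eq. (3.16)] -/
theorem pos0m_of_forall_sector0mForm_nonneg (F : ScanFunctional) (D : Dims) {Δ : ℝ} {ℓ : ℕ}
    (h : ∀ G : Label → ℝ → ℝ → ℝ, (∀ L ∈ labels0m, IsConformalBlock3D 0 0 Δ ℓ (G L)) →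
      ∀ b c : ℝ, 0 ≤ sector0mForm F D G b c) :
    Pos0m F.toFunctional D Δ ℓ := by
  intro g hg
  refine PosSemidef.of_dotProduct_mulVec_nonneg (isHermitian_alphaMat _ (V0m_transpose D g)) fun x => ?_
  have hx : x = ![x 0, x 1] := by
    funext i; fin_cases i <;> rfl
  rw [star_trivial, hx, sector0mForm_eq]
  exact h _ (isConformalBlock3D_of_genuineOn_labels0m hg) _ _

/-- `Pos4` of a scan functional from nonnegativity of the sector-`4` value. [cite: ChesterEtAl2020, §3.1 (functional conditions)] -/
theorem pos4_of_forall_sector4Value_nonneg (F : ScanFunctional) (D : Dims) {Δ : ℝ} {ℓ : ℕ}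
    (h : ∀ G : Label → ℝ → ℝ → ℝ, (∀ L ∈ labels4, IsConformalBlock3D 0 0 Δ ℓ (G L)) →
      0 ≤ sector4Value F D G) :
    Pos4 F.toFunctional D Δ ℓ := by
  intro g hg
  rw [sector4Value_eq]
  exact h _ (isConformalBlock3D_of_genuineOn_labels4 hg)

/-- **Sector `0⁺` at a regular `(Δ, ℓ)` from termwise PSD** (finite head + PSD tail terms): `Pos0p` of the
scan functional, i.e. `α(V⃗_{0⁺,Δ,ℓ}[g]) ⪰ 0` for every genuine family `g`.
[cite: HogervorstRychkov2013, §3 eqs. (3.6), (3.9)] [cite: KosPolandSimmonsduffin2014, §3.3 eq. (3.16)]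
[cite: ChesterEtAl2020, §3.1 (functional conditions)] -/
theorem pos0p_of_termwise (F : ScanFunctional) (D : Dims) {Δ : ℝ} {ℓ : ℕ}
    (hΔ : unitarityBound3D ℓ < Δ) (hreg : ¬ accidentalDegeneracy3D Δ ℓ) (S : Finset (ℕ × ℕ))
    (hhead : ∀ a b c : ℝ, 0 ≤ ∑ q ∈ S, hrCoeff Δ ℓ q.1 q.2 / legendreLam ℓ *
      sector0pTermForm F D (Δ + (q.1 : ℝ)) q.2 a b c)
    (htail : ∀ q : ℕ × ℕ, q ∉ S → InDescendantRange ℓ q.1 q.2 →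
      ∀ a b c : ℝ, 0 ≤ sector0pTermForm F D (Δ + (q.1 : ℝ)) q.2 a b c) :
    Pos0p F.toFunctional D Δ ℓ :=
  pos0p_of_forall_sector0pForm_nonneg F D fun _ hG =>
    sector0pForm_nonneg_of_termwise F D hΔ hreg S hhead htail hG

/-- **Fully termwise form, sector `0⁺`** (`S = ∅`). [cite: HogervorstRychkov2013, §3 eqs. (3.6), (3.9)]
[cite: ChesterEtAl2020, §3.1 (functional conditions)] -/
theorem pos0p_of_forall (F : ScanFunctional) (D : Dims) {Δ : ℝ} {ℓ : ℕ}
    (hΔ : unitarityBound3D ℓ < Δ) (hreg : ¬ accidentalDegeneracy3D Δ ℓ)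
    (hterm : ∀ q : ℕ × ℕ, InDescendantRange ℓ q.1 q.2 →
      ∀ a b c : ℝ, 0 ≤ sector0pTermForm F D (Δ + (q.1 : ℝ)) q.2 a b c) :
    Pos0p F.toFunctional D Δ ℓ :=
  pos0p_of_termwise F D hΔ hreg ∅ (by simp) (fun q _ hr => hterm q hr)

/-- **Sector `0⁻` at a regular `(Δ, ℓ)` from termwise PSD** (finite head + PSD tail terms).
[cite: HogervorstRychkov2013, §3 eqs. (3.6), (3.9)] [cite: KosPolandSimmonsduffin2014, §3.3 eq. (3.16)]
[cite: ChesterEtAl2020, §3.1 (functional conditions)] -/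
theorem pos0m_of_termwise (F : ScanFunctional) (D : Dims) {Δ : ℝ} {ℓ : ℕ}
    (hΔ : unitarityBound3D ℓ < Δ) (hreg : ¬ accidentalDegeneracy3D Δ ℓ) (S : Finset (ℕ × ℕ))
    (hhead : ∀ b c : ℝ, 0 ≤ ∑ q ∈ S, hrCoeff Δ ℓ q.1 q.2 / legendreLam ℓ *
      sector0mTermForm F D (Δ + (q.1 : ℝ)) q.2 b c)
    (htail : ∀ q : ℕ × ℕ, q ∉ S → InDescendantRange ℓ q.1 q.2 →
      ∀ b c : ℝ, 0 ≤ sector0mTermForm F D (Δ + (q.1 : ℝ)) q.2 b c) :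
    Pos0m F.toFunctional D Δ ℓ :=
  pos0m_of_forall_sector0mForm_nonneg F D fun _ hG =>
    sector0mForm_nonneg_of_termwise F D hΔ hreg S hhead htail hG

/-- **Fully termwise form, sector `0⁻`.** [cite: HogervorstRychkov2013, §3 eqs. (3.6), (3.9)]
[cite: ChesterEtAl2020, §3.1 (functional conditions)] -/
theorem pos0m_of_forall (F : ScanFunctional) (D : Dims) {Δ : ℝ} {ℓ : ℕ}
    (hΔ : unitarityBound3D ℓ < Δ) (hreg : ¬ accidentalDegeneracy3D Δ ℓ)
    (hterm : ∀ q : ℕ × ℕ, InDescendantRange ℓ q.1 q.2 →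
      ∀ b c : ℝ, 0 ≤ sector0mTermForm F D (Δ + (q.1 : ℝ)) q.2 b c) :
    Pos0m F.toFunctional D Δ ℓ :=
  pos0m_of_termwise F D hΔ hreg ∅ (by simp) (fun q _ hr => hterm q hr)

/-- **Sector `4` at a regular `(Δ, ℓ)` from termwise nonnegativity** (finite head + nonnegative tail terms).
[cite: HogervorstRychkov2013, §3 eqs. (3.6), (3.9)] [cite: ChesterEtAl2020, §3.1 (functional conditions)] -/
theorem pos4_of_termwise (F : ScanFunctional) (D : Dims) {Δ : ℝ} {ℓ : ℕ}
    (hΔ : unitarityBound3D ℓ < Δ) (hreg : ¬ accidentalDegeneracy3D Δ ℓ) (S : Finset (ℕ × ℕ))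
    (hhead : 0 ≤ ∑ q ∈ S, hrCoeff Δ ℓ q.1 q.2 / legendreLam ℓ * sector4Term F D (Δ + (q.1 : ℝ)) q.2)
    (htail : ∀ q : ℕ × ℕ, q ∉ S → InDescendantRange ℓ q.1 q.2 → 0 ≤ sector4Term F D (Δ + (q.1 : ℝ)) q.2) :
    Pos4 F.toFunctional D Δ ℓ :=
  pos4_of_forall_sector4Value_nonneg F D fun _ hG =>
    sector4Value_nonneg_of_termwise F D hΔ hreg S hhead htail hG

/-- **Fully termwise form, sector `4`.** [cite: HogervorstRychkov2013, §3 eqs. (3.6), (3.9)]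
[cite: ChesterEtAl2020, §3.1 (functional conditions)] -/
theorem pos4_of_forall (F : ScanFunctional) (D : Dims) {Δ : ℝ} {ℓ : ℕ}
    (hΔ : unitarityBound3D ℓ < Δ) (hreg : ¬ accidentalDegeneracy3D Δ ℓ)
    (hterm : ∀ q : ℕ × ℕ, InDescendantRange ℓ q.1 q.2 → 0 ≤ sector4Term F D (Δ + (q.1 : ℝ)) q.2) :
    Pos4 F.toFunctional D Δ ℓ :=
  pos4_of_termwise F D hΔ hreg ∅ (by simp) (fun q _ hr => hterm q hr)

/-! ### §4 Non-regular points by right limits -/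

/-- The `0⁺` sector form is continuous along the limit clause: if each `G_{Δ'} L → G L` pointwise on the
square (`L` a `0⁺` label) then `sector0pForm(G_{Δ'}) → sector0pForm(G)`. Elementary (finitely many node
values). [cite: KosPolandSimmonsduffin2014, §4 eqs. (4.2)–(4.3)] -/
theorem tendsto_sector0pForm (F : ScanFunctional) (D : Dims) (Gf : ℝ → Label → ℝ → ℝ → ℝ)
    (G : Label → ℝ → ℝ → ℝ) (l : Filter ℝ)
    (hG : ∀ L ∈ labels0p, ∀ x y : ℝ, x ∈ Ioo (0 : ℝ) 1 → y ∈ Ioo (0 : ℝ) 1 →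
      Tendsto (fun Δ' => Gf Δ' L x y) l (𝓝 (G L x y))) (a b c : ℝ) :
    Tendsto (fun Δ' => sector0pForm F D (Gf Δ') a b c) l (𝓝 (sector0pForm F D G a b c)) := by
  have T := fun (r : Fin 22) (x sgn : ℝ) {L : Label} (hL : L ∈ labels0p) =>
    tendsto_pointFunctional_crossF (fun m => F.w m r) F.z F.zb F.hz F.hzb x sgn (fun Δ' => Gf Δ' L) (G L) l
      (hG L hL)
  have hφ : Label.φφφφ ∈ labels0p := by simp [labels0p]
  have ht : Label.tttt ∈ labels0p := by simp [labels0p]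
  have hs : Label.ssss ∈ labels0p := by simp [labels0p]
  have hφt : Label.ttφφ ∈ labels0p := by simp [labels0p]
  have hst : Label.ttss ∈ labels0p := by simp [labels0p]
  have hφs : Label.φφss ∈ labels0p := by simp [labels0p]
  simp only [sector0pForm, nodeEval]
  exact ((((((T 12 (D.expo .ssss) (-1) hs).const_mul 2).const_mul (a ^ 2)).add
      ((((T 0 (D.expo .φφφφ) (-1) hφ).const_mul 2).sub ((T 2 (D.expo .φφφφ) 1 hφ).const_mul 2)).const_mul
        (b ^ 2))).add
      ((((T 3 (D.expo .tttt) (-1) ht).const_mul 2).sub ((T 5 (D.expo .tttt) 1 ht).const_mul 2)).const_mul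
        (c ^ 2))).add
      ((((((T 8 (D.expo .ttφφ) (-1) hφt).const_mul 2).add ((T 9 (D.expo .ttφφ) (-1) hφt).const_mul 2)).sub
        ((T 10 (D.expo .ttφφ) 1 hφt).const_mul 2)).sub ((T 11 (D.expo .ttφφ) 1 hφt).const_mul 2)).const_mul
        (b * c))).add
      ((((T 15 (D.expo .ttss) (-1) hst).const_mul 2).add ((T 16 (D.expo .ttss) 1 hst).const_mul 2)).const_mul
        (a * c)) |>.add
      ((((T 17 (D.expo .φφss) (-1) hφs).const_mul 2).add ((T 18 (D.expo .φφss) 1 hφs).const_mul 2)).const_mul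
        (a * b))

/-- The `0⁻` sector form is continuous along the limit clause. Elementary.
[cite: KosPolandSimmonsduffin2014, §4 eqs. (4.2)–(4.3)] -/
theorem tendsto_sector0mForm (F : ScanFunctional) (D : Dims) (Gf : ℝ → Label → ℝ → ℝ → ℝ)
    (G : Label → ℝ → ℝ → ℝ) (l : Filter ℝ)
    (hG : ∀ L ∈ labels0m, ∀ x y : ℝ, x ∈ Ioo (0 : ℝ) 1 → y ∈ Ioo (0 : ℝ) 1 →
      Tendsto (fun Δ' => Gf Δ' L x y) l (𝓝 (G L x y))) (b c : ℝ) :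
    Tendsto (fun Δ' => sector0mForm F D (Gf Δ') b c) l (𝓝 (sector0mForm F D G b c)) := by
  have T := fun (r : Fin 22) (x sgn : ℝ) {L : Label} (hL : L ∈ labels0m) =>
    tendsto_pointFunctional_crossF (fun m => F.w m r) F.z F.zb F.hz F.hzb x sgn (fun Δ' => Gf Δ' L) (G L) l
      (hG L hL)
  have hφ : Label.φφφφ ∈ labels0m := by simp [labels0m]
  have ht : Label.tttt ∈ labels0m := by simp [labels0m]
  have hφt : Label.ttφφ ∈ labels0m := by simp [labels0m]
  simp only [sector0mForm, nodeEval]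
  exact ((((((T 0 (D.expo .φφφφ) (-1) hφ).const_mul 2).sub ((T 1 (D.expo .φφφφ) (-1) hφ).const_mul 4)).add
        ((T 2 (D.expo .φφφφ) 1 hφ).const_mul 2)).const_mul (b ^ 2)).add
      (((((T 3 (D.expo .tttt) (-1) ht).const_mul 2).sub ((T 4 (D.expo .tttt) (-1) ht).const_mul 4)).add
        ((T 5 (D.expo .tttt) 1 ht).const_mul 2)).const_mul (c ^ 2))).add
      ((((((T 8 (D.expo .ttφφ) (-1) hφt).const_mul 2).neg.add ((T 9 (D.expo .ttφφ) (-1) hφt).const_mul 2)).add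
        ((T 10 (D.expo .ttφφ) 1 hφt).const_mul 2)).sub ((T 11 (D.expo .ttφφ) 1 hφt).const_mul 2)).const_mul
        (b * c))

/-- The sector-`4` value is continuous along the limit clause. Elementary.
[cite: KosPolandSimmonsduffin2014, §4 eqs. (4.2)–(4.3)] -/
theorem tendsto_sector4Value (F : ScanFunctional) (D : Dims) (Gf : ℝ → Label → ℝ → ℝ → ℝ)
    (G : Label → ℝ → ℝ → ℝ) (l : Filter ℝ)
    (hG : ∀ L ∈ labels4, ∀ x y : ℝ, x ∈ Ioo (0 : ℝ) 1 → y ∈ Ioo (0 : ℝ) 1 →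
      Tendsto (fun Δ' => Gf Δ' L x y) l (𝓝 (G L x y))) :
    Tendsto (fun Δ' => sector4Value F D (Gf Δ')) l (𝓝 (sector4Value F D G)) := by
  have ht : Label.tttt ∈ labels4 := by simp [labels4]
  have T := fun (r : Fin 22) (x sgn : ℝ) =>
    tendsto_pointFunctional_crossF (fun m => F.w m r) F.z F.zb F.hz F.hzb x sgn (fun Δ' => Gf Δ' .tttt)
      (G .tttt) l (hG .tttt ht)
  simp only [sector4Value, nodeEval]
  exact ((T 4 (D.expo .tttt) (-1)).const_mul 2).add ((T 5 (D.expo .tttt) 1).const_mul 2)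

/-- At a non-regular point every genuine `z`-coordinate block on the given labels is a pointwise right limit
of generic blocks (the limit clause of `IsConformalBlock3D`), with one approximating family per label.
[cite: KosPolandSimmonsduffin2014, §4 eqs. (4.2)–(4.3)] -/
theorem exists_approximants_of_not_isRegularPoint3D {Δ : ℝ} {ℓ : ℕ} (hΔ : ¬ IsRegularPoint3D Δ ℓ)
    (S : List Label) {G : Label → ℝ → ℝ → ℝ} (hG : ∀ L ∈ S, IsConformalBlock3D 0 0 Δ ℓ (G L)) :
    ∃ Gf : ℝ → Label → ℝ → ℝ → ℝ,
      (∀ L ∈ S, ∀ Δ' ∈ Ioo Δ (Δ + 1), IsConformalBlock3DAbove 0 0 Δ' ℓ (Gf Δ' L)) ∧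
      ∀ L ∈ S, ∀ x y : ℝ, x ∈ Ioo (0 : ℝ) 1 → y ∈ Ioo (0 : ℝ) 1 →
        Tendsto (fun Δ' => Gf Δ' L x y) (𝓝[>] Δ) (𝓝 (G L x y)) := by
  have hex : ∀ L : Label, ∃ H : ℝ → ℝ → ℝ → ℝ, L ∈ S →
      (∀ Δ' ∈ Ioo Δ (Δ + 1), IsConformalBlock3DAbove 0 0 Δ' ℓ (H Δ')) ∧
        ∀ x y : ℝ, x ∈ Ioo (0 : ℝ) 1 → y ∈ Ioo (0 : ℝ) 1 →
          Tendsto (fun Δ' => H Δ' x y) (𝓝[>] Δ) (𝓝 (G L x y)) := by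
    intro L
    by_cases hL : L ∈ S
    · rcases hG L hL with ⟨hreg, _⟩ | ⟨_, H, hHa, hHl⟩
      · exact absurd hreg hΔ
      · exact ⟨H, fun _ => ⟨hHa, hHl⟩⟩
    · exact ⟨fun _ _ _ => 0, fun h => absurd h hL⟩
  choose H hH using hex
  exact ⟨fun Δ' L => H L Δ', fun L hL => (hH L hL).1, fun L hL => (hH L hL).2⟩

/-- **Sector `0⁺` at a NON-REGULAR point from the right**: if `(Δ, ℓ)` is not regular and, for all `Δ'` in
a right neighbourhood of `Δ`, `(Δ', ℓ)` is regular and the `0⁺` sector form is `≥ 0` on every family of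
genuine `z`-coordinate blocks at `(Δ', ℓ)` (e.g. by `sector0pForm_nonneg_of_termwise`), then `Pos0p` holds
at `(Δ, ℓ)` (limit clause of `IsConformalBlock3D`, continuity of the form, `ge_of_tendsto`).
[cite: KosPolandSimmonsduffin2014, §4 eqs. (4.2)–(4.3)] [cite: ChesterEtAl2020, §3.1 (functional conditions)] -/
theorem pos0p_of_eventually_right (F : ScanFunctional) (D : Dims) {Δ : ℝ} {ℓ : ℕ}
    (hΔ : ¬ IsRegularPoint3D Δ ℓ)
    (h : ∀ᶠ Δ' in 𝓝[>] Δ, IsRegularPoint3D Δ' ℓ ∧ ∀ G : Label → ℝ → ℝ → ℝ,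
      (∀ L ∈ labels0p, IsConformalBlock3D 0 0 Δ' ℓ (G L)) → ∀ a b c : ℝ, 0 ≤ sector0pForm F D G a b c) :
    Pos0p F.toFunctional D Δ ℓ := by
  refine pos0p_of_forall_sector0pForm_nonneg F D fun G hG a b c => ?_
  obtain ⟨Gf, hGa, hGl⟩ := exists_approximants_of_not_isRegularPoint3D hΔ labels0p hG
  have hlim := tendsto_sector0pForm F D Gf G (𝓝[>] Δ) hGl a b c
  refine ge_of_tendsto hlim ?_
  have hIoo : Ioo Δ (Δ + 1) ∈ 𝓝[>] Δ := Ioo_mem_nhdsGT (by linarith)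
  filter_upwards [h, hIoo] with Δ' hΔ' hmem
  exact hΔ'.2 (Gf Δ') (fun L hL => Or.inl ⟨hΔ'.1, hGa L hL Δ' hmem⟩) a b c

/-- **Sector `0⁻` at a non-regular point from the right.** [cite: KosPolandSimmonsduffin2014, §4 eqs. (4.2)–(4.3)]
[cite: ChesterEtAl2020, §3.1 (functional conditions)] -/
theorem pos0m_of_eventually_right (F : ScanFunctional) (D : Dims) {Δ : ℝ} {ℓ : ℕ}
    (hΔ : ¬ IsRegularPoint3D Δ ℓ)
    (h : ∀ᶠ Δ' in 𝓝[>] Δ, IsRegularPoint3D Δ' ℓ ∧ ∀ G : Label → ℝ → ℝ → ℝ,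
      (∀ L ∈ labels0m, IsConformalBlock3D 0 0 Δ' ℓ (G L)) → ∀ b c : ℝ, 0 ≤ sector0mForm F D G b c) :
    Pos0m F.toFunctional D Δ ℓ := by
  refine pos0m_of_forall_sector0mForm_nonneg F D fun G hG b c => ?_
  obtain ⟨Gf, hGa, hGl⟩ := exists_approximants_of_not_isRegularPoint3D hΔ labels0m hG
  have hlim := tendsto_sector0mForm F D Gf G (𝓝[>] Δ) hGl b c
  refine ge_of_tendsto hlim ?_
  have hIoo : Ioo Δ (Δ + 1) ∈ 𝓝[>] Δ := Ioo_mem_nhdsGT (by linarith)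
  filter_upwards [h, hIoo] with Δ' hΔ' hmem
  exact hΔ'.2 (Gf Δ') (fun L hL => Or.inl ⟨hΔ'.1, hGa L hL Δ' hmem⟩) b c

/-- **Sector `4` at a non-regular point from the right.** [cite: KosPolandSimmonsduffin2014, §4 eqs. (4.2)–(4.3)]
[cite: ChesterEtAl2020, §3.1 (functional conditions)] -/
theorem pos4_of_eventually_right (F : ScanFunctional) (D : Dims) {Δ : ℝ} {ℓ : ℕ}
    (hΔ : ¬ IsRegularPoint3D Δ ℓ)
    (h : ∀ᶠ Δ' in 𝓝[>] Δ, IsRegularPoint3D Δ' ℓ ∧ ∀ G : Label → ℝ → ℝ → ℝ,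
      (∀ L ∈ labels4, IsConformalBlock3D 0 0 Δ' ℓ (G L)) → 0 ≤ sector4Value F D G) :
    Pos4 F.toFunctional D Δ ℓ := by
  refine pos4_of_forall_sector4Value_nonneg F D fun G hG => ?_
  obtain ⟨Gf, hGa, hGl⟩ := exists_approximants_of_not_isRegularPoint3D hΔ labels4 hG
  have hlim := tendsto_sector4Value F D Gf G (𝓝[>] Δ) hGl
  refine ge_of_tendsto hlim ?_
  have hIoo : Ioo Δ (Δ + 1) ∈ 𝓝[>] Δ := Ioo_mem_nhdsGT (by linarith)
  filter_upwards [h, hIoo] with Δ' hΔ' hmem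
  exact hΔ'.2 (Gf Δ') (fun L hL => Or.inl ⟨hΔ'.1, hGa L hL Δ' hmem⟩)

end Literature.MathematicalPhysics.QuantumFieldTheory.O2NeutralSectorsTermwise
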